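import Summits.MatrixMultiplication.MatrixMultiplication.Theses.DefinableSTPPDichotomy
import Summits.MatrixMultiplication.MatrixMultiplication.Theorems.PairwiseCurvedTilingsLC.Negative.PairwiseCurvedTilingsLCShadowCounting
import Literature.ModelTheory.PseudofiniteFields.DefinableTranslateRecurrenceLC

/-!
# `PairwiseCurvedTilingsLC` (crux stmt-MatrixMultiplication-17883) is FALSE modulo a
translate-recurrence principle for definable sets over finite fields of large characteristic

NEGATIVE LEMMA MODULO `H` (refuter / cdisprove seat, cycle 1):
`PairwiseCurvedTilingsLC_false_of_DefinableTranslateRecurrenceLC :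
   Literature.ModelTheory.PseudofiniteFields.DefinableTranslateRecurrenceLC → ¬ PairwiseCurvedTilingsLC`.

The mathematics is the conditional disproof found independently by the two crux-ideate seats of
round 1 (2026-08-17; crux workfiles `Cruxes/PairwiseCurvedTilingsLC/LonelyTranslates.lean`,
`ChebotarevRecurrenceSketch.lean`, notes `NEGATIVE-lonely-translates.md`,
`NEGATIVE-chebotarev-curve-recurrence.md`), re-cut for `Theorems/…/Negative/` with the hypothesis
stated in the crux's own regime of LARGE CHARACTERISTIC — weaker than the ideators'
all-characteristic named fact (which implies it, `ringChar F ≤ |F|`), hence a stronger lemma.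

`H := Literature.ModelTheory.PseudofiniteFields.DefinableTranslateRecurrenceLC` speaks of two ARBITRARY ring formulas and of no STPP notion;
it is a theorem of classical arithmetic geometry whose proof Mathlib cannot yet express (Galois
stratification [Kiefe1976], uniform effective Chebotarev for finite étale Galois covers of
varieties over finite fields [KatzSarnak1998, Thm 9.7.13], Lang–Weil [LangWeil1954],
Chatzidakis–van den Dries–Macintyre [ChatzidakisVanDenDriesMacintyre1992]); hand proof in its
docstring.  The reduction: §1 the shadow `⋃_x (B_x − C_x)` and the block `A_x` as realised ring
formulas (`shadowFormula`, `blockFormula`) so that `H` applies to them; §2 `H`, and the count at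
`ε := 1/(m+1)` using `bcShadow_le_of_recurrence` + `mass_le_of_bcShadowBound` of
`PairwiseCurvedTilingsLCShadowCounting.lean`: `|F|^{m+η} ≤ mass ≤ K_c|F|^m < |F|^{m+η}`.

What the kill CONSUMES from the crux (load-bearing): block TPP; ONE porosity pattern in full
(`k = i`); the other two 2-label patterns only as packings; the mass bound at the single exponent
`ε = 1/(m+1)` with its `η > 0`; definability of `I, A, B, C`; `char F → ∞`.  NOT consumed: the
`∀ ε`, the size of `η`, the 3-distinct-label (hexagon) pattern, frames/cones, Fourier decay.  Given
`H` there is no restatement of the dodge inside the definable world: unbounded blocks cannot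
escape even one porosity, and bounded blocks never beat `|F|^m` (`UniformEta.sum_rpow_le_card_rpow`).

References: C. Kiefe, Trans. AMS 223 (1976) 45–59; Z. Chatzidakis, L. van den Dries,
A. Macintyre, J. reine angew. Math. 427 (1992) 107–135; S. Lang, A. Weil, Amer. J. Math. 76 (1954)
819–827; N. M. Katz, P. Sarnak, Random Matrices, Frobenius Eigenvalues, and Monodromy, AMS Colloq.
Publ. 45 (1999), Thm 9.7.13 and Remark 9.7.11.
-/

set_option linter.dupNamespace false  -- `Summit.<S>.<S>.…` is the mandated namespace

namespace Summit.MatrixMultiplication.MatrixMultiplication.Theorems.PairwiseCurvedTilingsLC.Negative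

open Finset

/-! ## §1 The shadow and the block as realised ring formulas -/

section Formulas

open FirstOrder FirstOrder.Language

variable {e m k : ℕ}

/-- Relabelling of `φ_I`'s variables inside the shadow formula: `x` bound, `y` free. -/
def relabI (e m k : ℕ) : Fin e ⊕ Fin k → (Fin m ⊕ Fin k) ⊕ (Fin e ⊕ (Fin m ⊕ Fin m))
  | Sum.inl xi => Sum.inr (Sum.inl xi)
  | Sum.inr yi => Sum.inl (Sum.inr yi)

/-- Relabelling of `φ_B`'s variables: `x`, `b` bound, `y` free. -/
def relabB (e m k : ℕ) : (Fin e ⊕ Fin m) ⊕ Fin k → (Fin m ⊕ Fin k) ⊕ (Fin e ⊕ (Fin m ⊕ Fin m))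
  | Sum.inl (Sum.inl xi) => Sum.inr (Sum.inl xi)
  | Sum.inl (Sum.inr bi) => Sum.inr (Sum.inr (Sum.inl bi))
  | Sum.inr yi => Sum.inl (Sum.inr yi)

/-- Relabelling of `φ_C`'s variables: `x`, `c` bound, `y` free. -/
def relabC (e m k : ℕ) : (Fin e ⊕ Fin m) ⊕ Fin k → (Fin m ⊕ Fin k) ⊕ (Fin e ⊕ (Fin m ⊕ Fin m))
  | Sum.inl (Sum.inl xi) => Sum.inr (Sum.inl xi)
  | Sum.inl (Sum.inr ci) => Sum.inr (Sum.inr (Sum.inr ci))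
  | Sum.inr yi => Sum.inl (Sum.inr yi)

/-- The ring formula `τ(w; y) := ∃x ∃b ∃c, φ_I(x;y) ∧ φ_B(x,b;y) ∧ φ_C(x,c;y) ∧ ⋀_i w_i = b_i − c_i`
cutting out the shadow `⋃_{x ∈ I} (B_x − C_x)`. -/
noncomputable def shadowFormula (φI : Language.ring.Formula (Fin e ⊕ Fin k))
    (φB φC : Language.ring.Formula ((Fin e ⊕ Fin m) ⊕ Fin k)) :
    Language.ring.Formula (Fin m ⊕ Fin k) :=
  Formula.iExs (Fin e ⊕ (Fin m ⊕ Fin m))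
    (φI.relabel (relabI e m k) ⊓ φB.relabel (relabB e m k) ⊓ φC.relabel (relabC e m k) ⊓
      Formula.iInf fun i : Fin m =>
        Term.equal (Term.var (Sum.inl (Sum.inl i)))
          (Term.var (Sum.inr (Sum.inr (Sum.inl i))) + -Term.var (Sum.inr (Sum.inr (Sum.inr i)))))

/-- Relabelling of `φ_A`'s variables presenting `A_x` with parameters `(x, y)` appended. -/
def relabA (e m k : ℕ) : (Fin e ⊕ Fin m) ⊕ Fin k → Fin m ⊕ Fin (e + k)
  | Sum.inl (Sum.inl xi) => Sum.inr (Fin.castAdd k xi)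
  | Sum.inl (Sum.inr vi) => Sum.inl vi
  | Sum.inr yi => Sum.inr (Fin.natAdd e yi)

/-- The ring formula `α(v; x, y) := φ_A(x, v; y)` cutting out the block `A_x`. -/
def blockFormula (φA : Language.ring.Formula ((Fin e ⊕ Fin m) ⊕ Fin k)) :
    Language.ring.Formula (Fin m ⊕ Fin (e + k)) :=
  φA.relabel (relabA e m k)

/-- Realisation of a finite conjunction of formulas. -/
theorem realize_formula_iInf {L : Language} {M : Type*} [L.Structure M] [Nonempty M] {α β : Type*}
    [Finite β] {f : β → L.Formula α} {v : α → M} :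
    (Formula.iInf f).Realize v ↔ ∀ b, (f b).Realize v := by
  simp only [Formula.iInf, Formula.Realize, BoundedFormula.realize_iInf]

variable {F : Type} [Field F] [FirstOrder.Ring.CompatibleRing F]

/-- Realisation of the shadow formula. -/
theorem mem_bcShadow_iff_realize [DecidableEq F] {φI : Language.ring.Formula (Fin e ⊕ Fin k)}
    {φB φC : Language.ring.Formula ((Fin e ⊕ Fin m) ⊕ Fin k)} {y : Fin k → F}
    {I : Finset (Fin e → F)} {B C : (Fin e → F) → Finset (Fin m → F)}
    (hI : ∀ x, x ∈ I ↔ φI.Realize (Sum.elim x y))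
    (hB : ∀ x v, v ∈ B x ↔ φB.Realize (Sum.elim (Sum.elim x v) y))
    (hC : ∀ x v, v ∈ C x ↔ φC.Realize (Sum.elim (Sum.elim x v) y)) (w : Fin m → F) :
    w ∈ Finset.biUnion I (fun x => Finset.image₂ (fun b c => b - c) (B x) (C x)) ↔
      (shadowFormula φI φB φC).Realize (Sum.elim w y) := by
  classical
  simp only [mem_biUnion, mem_image₂, shadowFormula, Formula.realize_iExs,
    Formula.realize_inf, Formula.realize_relabel, realize_formula_iInf, Formula.realize_equal,
    Term.realize_var, Sum.elim_inl, Sum.elim_inr, FirstOrder.Ring.realize_add,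
    FirstOrder.Ring.realize_neg]
  constructor
  · rintro ⟨x, hx, b, hb, c, hc, rfl⟩
    refine ⟨Sum.elim x (Sum.elim b c), ⟨⟨?_, ?_⟩, ?_⟩, ?_⟩
    · rw [hI] at hx
      convert hx using 2
      funext a; cases a <;> rfl
    · rw [hB] at hb
      convert hb using 2
      funext a; rcases a with (a | a) | a <;> rfl
    · rw [hC] at hc
      convert hc using 2
      funext a; rcases a with (a | a) | a <;> rfl
    · intro i
      simp [sub_eq_add_neg]
  · rintro ⟨g, ⟨⟨hx, hb⟩, hc⟩, hw⟩
    refine ⟨g ∘ Sum.inl, ?_, g ∘ Sum.inr ∘ Sum.inl, ?_, g ∘ Sum.inr ∘ Sum.inr, ?_, ?_⟩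
    · rw [hI]
      convert hx using 2
      funext a; cases a <;> rfl
    · rw [hB]
      convert hb using 2
      funext a; rcases a with (a | a) | a <;> rfl
    · rw [hC]
      convert hc using 2
      funext a; rcases a with (a | a) | a <;> rfl
    · funext i
      have := hw i
      simp only [Function.comp_apply, Pi.sub_apply]
      rw [this, sub_eq_add_neg]

/-- Realisation of the block formula with appended parameters `Fin.append x y`. -/
theorem mem_block_iff_realize {φA : Language.ring.Formula ((Fin e ⊕ Fin m) ⊕ Fin k)}
    {y : Fin k → F} {A : (Fin e → F) → Finset (Fin m → F)}
    (hA : ∀ x v, v ∈ A x ↔ φA.Realize (Sum.elim (Sum.elim x v) y)) (x : Fin e → F)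
    (v : Fin m → F) : v ∈ A x ↔ (blockFormula φA).Realize (Sum.elim v (Fin.append x y)) := by
  rw [hA, blockFormula, Formula.realize_relabel]
  refine Iff.of_eq (congrArg _ ?_)
  funext a
  rcases a with (a | a) | a
  · simp [relabA]
  · simp [relabA]
  · simp [relabA]

end Formulas

/-! ## §2 The hypothesis `H` (large characteristic) and the negative lemma -/

/-- **THE NEGATIVE LEMMA: `DefinableTranslateRecurrenceLC → ¬ PairwiseCurvedTilingsLC`.**
Apply `H` to `τ := shadowFormula φI φB φC` (the shadow `⋃_x (B_x − C_x)`) and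
`α := blockFormula φA` (the block `A_x`, parameters `(x, y)`); take `ε := 1/(m+1)` in the crux,
get `η > 0` and a field of characteristic `≥ max Q N 2` with a realised family of mass
`≥ |F|^{m+η}`; `bcShadow_le_of_recurrence` bounds the big blocks' `B − C` shadow by
`|E| ≤ C|F|^{m−1}`, and `mass_le_of_bcShadowBound` then caps the mass at `K_c|F|^m < |F|^{m+η}`. -/
theorem PairwiseCurvedTilingsLC_false_of_DefinableTranslateRecurrenceLC
    (hR : Literature.ModelTheory.PseudofiniteFields.DefinableTranslateRecurrenceLC) :
    ¬ Summit.MatrixMultiplication.MatrixMultiplication.Theses.DefinableSTPPDichotomy.PairwiseCurvedTilingsLC := by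
  intro hLC
  classical
  obtain ⟨e, m, k, φI, φA, φB, φC, hfam⟩ := hLC
  obtain ⟨Q, K, Cc, c, hc, hrec⟩ := hR m k (e + k) (shadowFormula φI φB φC) (blockFormula φA)
  set Cb : ℕ := max K (Nat.ceil (1 / c)) with hCb
  set ε : ℝ := 1 / ((m : ℝ) + 1) with hεdef
  have hm0 : (0 : ℝ) ≤ m := Nat.cast_nonneg m
  have hε : 0 < ε := by rw [hεdef]; positivity
  have hε1 : ε ≤ 1 := by
    rw [hεdef, div_le_one (by linarith)]; linarith
  have hmε : (m : ℝ) * ε ≤ 1 := by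
    rw [hεdef, mul_one_div, div_le_one (by linarith)]; linarith
  obtain ⟨η, hη, hall⟩ := hfam ε hε
  -- `Cc` may be negative a priori; work with `C₁ := max Cb ⌈max Cc 0⌉`
  set C₁ : ℕ := max Cb (Nat.ceil (max Cc 0)) with hC₁
  set Kc : ℝ := (C₁ : ℝ) + (2 + C₁) / 3 with hK
  have hK0 : 0 < Kc := by rw [hK]; positivity
  set N : ℕ := Nat.ceil ((Kc + 1) ^ (1 / η)) with hN
  obtain ⟨F, instF, instFin, instCR, hchar, y, I, A, B, C', hI, hA, hB, hC, hpair, hmass⟩ :=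
    hall (max Q (max N 2))
  have hcardF : max Q (max N 2) ≤ Fintype.card F := hchar.trans (ringChar_le_card F)
  set q : ℝ := (Fintype.card F : ℝ) with hqdef
  have hq2 : (2 : ℝ) ≤ q := by
    rw [hqdef]; exact_mod_cast le_trans (le_max_right _ _) (le_trans (le_max_right _ _) hcardF)
  have hq1 : (1 : ℝ) ≤ q := by linarith
  have hq0 : (0 : ℝ) < q := by linarith
  have hKq : Kc < q ^ η := by
    have h1 : (Kc + 1) ^ (1 / η) ≤ q := by
      have : (N : ℝ) ≤ q := by
        rw [hqdef]; exact_mod_cast le_trans (le_max_left _ _) (le_trans (le_max_right _ _) hcardF)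
      exact le_trans (Nat.le_ceil _) this
    have h2 : Kc + 1 ≤ q ^ η := by
      calc Kc + 1 = ((Kc + 1) ^ (1 / η)) ^ η := by
            rw [← Real.rpow_mul (by positivity), one_div, inv_mul_cancel₀ hη.ne', Real.rpow_one]
        _ ≤ q ^ η := Real.rpow_le_rpow (by positivity) h1 hη.le
    linarith
  -- recurrence data for this field (characteristic `≥ Q`) and these parameters
  obtain ⟨E, hE, hrecE⟩ := hrec F (le_trans (le_max_left _ _) hchar) y
  have hrec' : ∀ x ∈ I, K < (A x).card → ∀ t ∈ Finset.biUnion I (fun x => Finset.image₂ (fun b c => b - c) (B x) (C' x)), t ∉ E →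
      c * ((A x).card : ℝ) ^ 2 ≤ ((((A x) ×ˢ (A x)).filter
        fun p : (Fin m → F) × (Fin m → F) =>
          t + p.2 - p.1 ∈ Finset.biUnion I (fun x => Finset.image₂ (fun b c => b - c) (B x) (C' x))).card : ℝ) := by
    intro x _ hKx t ht htE
    have := hrecE (Fin.append x y) (Finset.biUnion I (fun x => Finset.image₂ (fun b c => b - c) (B x) (C' x))) (A x)
      (mem_bcShadow_iff_realize hI hB hC) (mem_block_iff_realize hA x) hKx t ht htE
    convert this using 2
  have hsh := bcShadow_le_of_recurrence hpair E hc hrec'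
  -- the shadow bound with the natural constant `C₁ ≥ Cb`
  have hshadow : ∑ x ∈ I.filter (fun x => C₁ < (A x).card), ((B x).card : ℝ) * (C' x).card
      ≤ C₁ * q ^ ((m : ℝ) - 1) := by
    have hsub : I.filter (fun x => C₁ < (A x).card) ⊆ I.filter fun x => Cb < (A x).card := by
      intro x hx
      obtain ⟨hxI, hxA⟩ := mem_filter.1 hx
      exact mem_filter.2 ⟨hxI, lt_of_le_of_lt (le_max_left _ _) hxA⟩
    calc ∑ x ∈ I.filter (fun x => C₁ < (A x).card), ((B x).card : ℝ) * (C' x).card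
        ≤ ∑ x ∈ I.filter (fun x => Cb < (A x).card), ((B x).card : ℝ) * (C' x).card :=
          sum_le_sum_of_subset_of_nonneg hsub fun x _ _ => by positivity
      _ = ((∑ x ∈ I.filter (fun x => Cb < (A x).card), (B x).card * (C' x).card : ℕ) : ℝ) := by
          push_cast; rfl
      _ ≤ E.card := by exact_mod_cast hsh
      _ ≤ Cc * q ^ ((m : ℝ) - 1) := hE
      _ ≤ C₁ * q ^ ((m : ℝ) - 1) := by
          gcongr
          calc Cc ≤ max Cc 0 := le_max_left _ _
            _ ≤ (Nat.ceil (max Cc 0) : ℝ) := Nat.le_ceil _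
            _ ≤ (C₁ : ℝ) := by rw [hC₁]; exact_mod_cast le_max_right _ _
  -- mass bound, and the contradiction `q^{m+η} ≤ mass ≤ Kc q^m < q^η q^m`
  have hH : (Fintype.card (Fin m → F) : ℝ) = q ^ (m : ℝ) := by
    rw [Real.rpow_natCast, Fintype.card_fun, Fintype.card_fin]; push_cast; rfl
  have hmassle := mass_le_of_bcShadowBound hpair C₁ hq1 m hH hshadow hε hε1 hmε
  have hlt : Kc * q ^ (m : ℝ) < q ^ ((m : ℝ) + η) := by
    rw [Real.rpow_add hq0, mul_comm]
    exact mul_lt_mul_of_pos_left hKq (Real.rpow_pos_of_pos hq0 _)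
  exact absurd (hmass.trans hmassle) (not_le.2 hlt)

end Summit.MatrixMultiplication.MatrixMultiplication.Theorems.PairwiseCurvedTilingsLC.Negative
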